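import Summits.SmoothPoincare4.SmoothPoincare4.Theses.InformationMetricHadamard
import Summits.SmoothPoincare4.SmoothPoincare4.Theorems.InformationMetricHadamardC0AhRecognitionStubGradientLikeFieldAux1
import Summits.SmoothPoincare4.SmoothPoincare4.Theorems.InformationMetricHadamardC0AhRecognitionStubGradientLikeFieldAux3
import Summits.SmoothPoincare4.SmoothPoincare4.Theorems.InformationMetricHadamardC0AhRecognitionStubGradientLikeFieldAux4
import Summits.SmoothPoincare4.SmoothPoincare4.Theorems.InformationMetricHadamardC0AhRecognitionStubGradientLikeFieldAux6
import Literature.Geometry.Riemannian.CartanHadamardLift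
import Mathlib.Geometry.Manifold.PartitionOfUnity

/-!
# Line `core-distance-morse`, crux `InformationMetricHadamard.C0AhRecognition` (stmt-SmoothPoincare4-6015) — stub `stub_gradientLikeField` (E1, apex)

**Grove–Shiohama noncritical Morse theory for the distance to a subcritical compact core in a
Cartan–Hadamard manifold.** Let `(W⁵, G)` be complete, simply connected, `sec ≤ 0`, and
`K ⊆ W` compact with the `ρ`-spread property, `ρ < √2` (any two nearest points `k₁, k₂ ∈ K` of
`y ∉ K` satisfy `d(k₁, k₂) ≤ ρ d(y, K)`). Then for every `a > 0` there is a smooth vector field `X`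
with `|X|_G ≤ 1`, along whose integral curves `f = d_G(·, K)` grows at a uniform rate `δ > 0` on
`{f ≥ a}`, and which is the unit radial field `(exp_o)_*(v/|v|)` outside a ball.

Proof (Grove–Shiohama 1977, §1; Petersen 2016, §12.1): helpers 1–6 of this directory supply the
polar package `Ex p = exp_p` (1-Lipschitz inverse = Rauch + calibration, Gauss, reversal), the
derivative of `d_G(k, ·)` along curves, the Lyapunov lemma (Danskin + real induction), the near-
and far-field regular directions with margin `μ`, and the smooth unit radial fields `Y_p`. Here
the field is PATCHED: the admissible sets
`t(z) = {|Y| ≤ 1} ∩ {margin μ against all η-almost nearest points, if f(z) ≥ a/2} ∩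
{Y = Y_o(z), if d(o,z) ≥ R₀}` are convex, and locally realised by `Y_o` (far: `d(o,·) > 2D + 1`),
by `0` (where `f < a/2`), and by `Y_{k₁}` for a nearest point `k₁` (near; a finite cover of the
compact `{d(o,·) ≤ 2D+1} ∩ {f ≥ a/2}` fixes a uniform `η`), so Mathlib's
`exists_contMDiffSection_forall_mem_convex_of_local` (smooth partitions of unity) gives a global
smooth section of `TW` in `t`.

Everything is proved (kind = proof); no definitions.
-/

noncomputable section

-- the prescribed namespace `Summit.<P>.<Sub>.…` duplicates `SmoothPoincare4` (P = Sub)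
set_option linter.dupNamespace false

open scoped Manifold ContDiff Topology ENNReal NNReal
open Set Function Bundle Filter

namespace Summit.SmoothPoincare4.SmoothPoincare4.Cruxes.C0AhRecognition.CoreDistanceMorse

open Literature.Topology.FourManifolds (HomotopySphere)
open Literature.Geometry.Lorentzian (PseudoRiemannianMetric)

set_option backward.isDefEq.respectTransparency false in
set_option maxHeartbeats 3200000 in
/-- **Stub E1 (`gradientLikeField`, the apex).** Let `(W, G)` be Cartan–Hadamard (closed balls
compact, simply connected, `sec ≤ 0`) and `K ⊆ W` compact with the `ρ`-spread property, `ρ < √2`: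
any two nearest points `k₁, k₂ ∈ K` of a point `y ∉ K` satisfy `d(k₁,k₂) ≤ ρ d(y,K)`. Then for every
`a > 0` there are a smooth vector field `X` with `|X|_G ≤ 1`, constants `δ > 0`, `R₀ > 0`, a point `o`
and a diffeomorphism `e : ℝ⁵ ≅ W` with `e 0 = o` and `d(o, e v) = |v|_{G_o}` such that
(i) `f = d(·,K)` grows at rate `≥ δ` along every integral curve of `X` started in `{f ≥ a}`, and
(ii) `X = e_*(v/|v|_{G_o})` at `e v` whenever `|v|_{G_o} ≥ R₀`.
Proof: Grove–Shiohama critical point theory of distance functions — see the module docstring;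
inputs: stubs R (Rauch comparison) and L (calibration) through helper 1, helpers 2–6.
[cite: GroveShiohama1977, §1; Petersen2016, §12.1] -/
theorem stub_gradientLikeField
    (W : Type) [TopologicalSpace W] [T2Space W] [SecondCountableTopology W]
    [ChartedSpace (EuclideanSpace ℝ (Fin 5)) W] [IsManifold (𝓡 5) ∞ W] [SimplyConnectedSpace W]
    (G : PseudoRiemannianMetric (𝓡 5) ∞ (EuclideanSpace ℝ (Fin 5)) (TangentSpace (𝓡 5) : W → Type _))
    (hG : G.IsRiemannian)
    (hcpt : ∀ (x : W) (r : NNReal), IsCompact {y : W | G.edist hG x y ≤ r})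
    (hsec : ∀ cov, G.IsLeviCivita cov →
      ∀ (x : W) (X Y : TangentSpace (𝓡 5) x), G.sectionalCurvature cov x X Y ≤ 0)
    (K : Set W) (hK : IsCompact K) (ρ : ℝ) (hρ : ρ < Real.sqrt 2)
    (hspread : ∀ y ∈ Kᶜ, ∀ k₁ ∈ K, ∀ k₂ ∈ K,
      G.edist hG y k₁ = ⨅ k ∈ K, G.edist hG y k → G.edist hG y k₂ = ⨅ k ∈ K, G.edist hG y k →
      G.edist hG k₁ k₂ ≤ ENNReal.ofReal ρ * ⨅ k ∈ K, G.edist hG y k)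
    (a : ℝ) (ha : 0 < a) :
    ∃ (X : Π y : W, TangentSpace (𝓡 5) y) (δ : ℝ) (o : W) (R₀ : ℝ)
      (e : EuclideanSpace ℝ (Fin 5) ≃ₘ^∞⟮𝓡 5, 𝓡 5⟯ W),
      0 < δ ∧ 0 < R₀ ∧
      ContMDiff (𝓡 5) (𝓡 5).tangent ∞ (fun y ↦ (⟨y, X y⟩ : TangentBundle (𝓡 5) W)) ∧
      (∀ y : W, G.val y (X y) (X y) ≤ 1) ∧
      (∀ (γ : ℝ → W) (t₁ t₂ : ℝ), t₁ ≤ t₂ → IsMIntegralCurveOn γ X (Icc t₁ t₂) →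
        ENNReal.ofReal a ≤ ⨅ k ∈ K, G.edist hG (γ t₁) k →
        (⨅ k ∈ K, G.edist hG (γ t₁) k) + ENNReal.ofReal (δ * (t₂ - t₁)) ≤
          ⨅ k ∈ K, G.edist hG (γ t₂) k) ∧
      e 0 = o ∧
      (∀ v : EuclideanSpace ℝ (Fin 5),
        G.edist hG o (e v) = ENNReal.ofReal (Real.sqrt (G.val o v v))) ∧
      (∀ v : EuclideanSpace ℝ (Fin 5), R₀ ≤ Real.sqrt (G.val o v v) →
        X (e v) = mfderiv (𝓡 5) (𝓡 5) e v ((Real.sqrt (G.val o v v))⁻¹ • v)) := by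
  -- ### the polar package and the base point
  obtain ⟨Ex, h0, hpol, hlip, hgauss, hrev⟩ := helper_gradientLikeField_1 W G hG hcpt hsec
  haveI : PathConnectedSpace W := inferInstance
  obtain ⟨o⟩ : Nonempty W := inferInstance
  set e := Ex o with he
  -- positive semidefiniteness of `G`
  have hnn : ∀ (x : W) (v : TangentSpace (𝓡 5) x), 0 ≤ G.val x v v := fun x v ↦ by
    by_cases hv : v = 0
    · subst hv; simp
    · exact (hG x v hv).le
  -- ### the distance structure; `f = infEDist(·, K)`; finiteness
  letI := G.riemannianBundle hG
  haveI := G.isContinuousRiemannianBundle hG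
  haveI : LocallyCompactSpace W := ChartedSpace.locallyCompactSpace (EuclideanSpace ℝ (Fin 5)) W
  letI : PseudoEMetricSpace W := .ofRiemannianMetric (𝓡 5) W
  have hed : ∀ y z : W, G.edist hG y z = edist y z := fun _ _ ↦ rfl
  set f : W → ℝ≥0∞ := fun y ↦ ⨅ k ∈ K, G.edist hG y k with hf
  have hfE : ∀ y : W, f y = Metric.infEDist y K := fun _ ↦ rfl
  have hfin : ∀ y z : W, G.edist hG y z ≠ ⊤ := edist_ne_top_of_polar G hG Ex hpol
  have hfc : Continuous f := by
    have : Continuous fun y : W ↦ Metric.infEDist y K := Metric.continuous_infEDist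
    exact this
  have hfle : ∀ (y : W), ∀ k ∈ K, f y ≤ G.edist hG y k := fun y k hk ↦ by
    rw [hfE, hed]; exact Metric.infEDist_le_edist_of_mem hk
  -- the radius function `r = d(o, ·)`
  set r : W → ℝ := fun z ↦ (G.edist hG o z).toReal with hr
  have hrc : Continuous r :=
    ENNReal.continuousOn_toReal.comp_continuous
      ((G.continuous_edist hG).comp (Continuous.prodMk_right o)) fun z ↦ hfin o z
  have hre : ∀ v : EuclideanSpace ℝ (Fin 5), r (e v) = Real.sqrt (G.val o v v) := fun v ↦ by
    show (G.edist hG o (Ex o v)).toReal = _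
    rw [hpol, ENNReal.toReal_ofReal (Real.sqrt_nonneg _)]
  have hro : r o = 0 := by
    show (G.edist hG o o).toReal = 0
    rw [G.edist_self hG, ENNReal.toReal_zero]
  -- ### constants
  set ρp : ℝ := max ρ 0 with hρp
  have hρp2 : ρp ^ 2 < 2 := by
    rcases le_or_gt 0 ρ with h | h
    · rw [hρp, max_eq_left h]
      have h2 : Real.sqrt 2 ^ 2 = 2 := Real.sq_sqrt (by norm_num)
      nlinarith [hρ, Real.sqrt_nonneg 2]
    · rw [hρp, max_eq_right h.le]; norm_num
  set μ : ℝ := min (1 / 2) ((2 - ρp ^ 2) / 4) with hμ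
  have hμ0 : 0 < μ := lt_min (by norm_num) (by linarith)
  have hμh : μ ≤ 1 / 2 := min_le_left _ _
  have hμρ : 2 * μ < 2 - (max ρ 0) ^ 2 := by
    have : μ ≤ (2 - ρp ^ 2) / 4 := min_le_right _ _
    rw [← hρp]; linarith
  -- the bound `D ≥ d(o, k)` on `K`
  obtain ⟨C₀, hC₀⟩ := hK.exists_bound_of_continuousOn (f := fun k ↦ (G.edist hG o k).toReal)
    hrc.continuousOn
  set D : ℝ := max C₀ 0 with hD
  have hD0 : 0 ≤ D := le_max_right _ _
  have hDK : ∀ k ∈ K, G.edist hG o k ≤ ENNReal.ofReal D := by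
    intro k hk
    have h1 : (G.edist hG o k).toReal ≤ D := by
      have := hC₀ k hk
      rw [Real.norm_eq_abs, abs_of_nonneg ENNReal.toReal_nonneg] at this
      exact this.trans (le_max_left _ _)
    exact (ENNReal.le_ofReal_iff_toReal_le (hfin o k) hD0).2 h1
  set R₁ : ℝ := 2 * D + 1 with hR₁
  set R₀ : ℝ := R₁ + 1 with hR₀
  have hR₀0 : 0 < R₀ := by rw [hR₀, hR₁]; linarith
  -- ### the smooth unit radial fields `Y p` (helper 6)
  have hY := fun p : W ↦ helper_gradientLikeField_6 W G hG Ex h0 hpol hgauss hrev p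
  choose Y hYs hYunit hYeq hYrad using hY
  -- ### the uniform almost-nearest scale `η` (finite cover of the compact near region)
  set Cn : Set W := {z : W | G.edist hG o z ≤ ((R₁.toNNReal : NNReal) : ℝ≥0∞)} ∩
    {z : W | ENNReal.ofReal (a / 2) ≤ f z} with hCn
  have hCnc : IsCompact Cn :=
    (hcpt o R₁.toNNReal).inter_right (isClosed_le continuous_const hfc)
  have hR₁0 : 0 ≤ R₁ := by rw [hR₁]; linarith
  have hmemCn : ∀ z : W, r z ≤ R₁ → ENNReal.ofReal (a / 2) ≤ f z → z ∈ Cn := by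
    intro z hz hfz
    refine ⟨?_, hfz⟩
    show G.edist hG o z ≤ ((R₁.toNNReal : NNReal) : ℝ≥0∞)
    have : G.edist hG o z ≤ ENNReal.ofReal R₁ := (ENNReal.le_ofReal_iff_toReal_le (hfin o z) hR₁0).2 hz
    exact this
  have hcover : ∃ η : ℝ, 0 < η ∧ ∀ x ∈ Cn, K.Nonempty → ∃ (k₁ : W) (O : Set W), IsOpen O ∧ x ∈ O ∧
      (∀ z ∈ O, z ≠ k₁) ∧
      ∀ z ∈ O, ∀ k ∈ K, G.edist hG z k ≤ (⨅ k' ∈ K, G.edist hG z k') + ENNReal.ofReal η →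
        μ * (G.edist hG z k₁).toReal * (G.edist hG z k).toReal ≤
          G.val z ((Ex z).symm k₁) ((Ex z).symm k) := by
    rcases K.eq_empty_or_nonempty with hKe | hKne
    · exact ⟨1, one_pos, fun x _ hne ↦ absurd hne (by rw [hKe]; exact Set.not_nonempty_empty)⟩
    -- local data at every point of `Cn` (helper 4 at a nearest point)
    have hloc : ∀ x ∈ Cn, ∃ (k₁ : W) (O : Set W), IsOpen O ∧ x ∈ O ∧ ∃ η₀ : ℝ, 0 < η₀ ∧
        ∀ z ∈ O, z ≠ k₁ ∧ ∀ k ∈ K,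
          G.edist hG z k ≤ (⨅ k' ∈ K, G.edist hG z k') + ENNReal.ofReal η₀ →
          μ * (G.edist hG z k₁).toReal * (G.edist hG z k).toReal ≤
            G.val z ((Ex z).symm k₁) ((Ex z).symm k) := by
      intro x hx
      obtain ⟨k₁, hk₁K, hk₁⟩ := hK.exists_infEDist_eq_edist hKne x
      have hfx : 0 < ⨅ k ∈ K, G.edist hG x k :=
        lt_of_lt_of_le (ENNReal.ofReal_pos.2 (by linarith)) hx.2
      have hnear : G.edist hG x k₁ = ⨅ k ∈ K, G.edist hG x k := hk₁.symm
      obtain ⟨O, hOo, hxO, η₀, hη₀, hO⟩ := helper_gradientLikeField_4 W G hG Ex hpol hlip K hK ρ μ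
        hμ0 hμρ hspread x k₁ hk₁K hfx hnear
      exact ⟨k₁, O, hOo, hxO, η₀, hη₀, hO⟩
    choose! k₁f Of hOo hxO ηf hη0 hO using hloc
    obtain ⟨T, hTC, hTcov⟩ := hCnc.elim_nhds_subcover Of fun x hx ↦ (hOo x hx).mem_nhds (hxO x hx)
    -- the uniform scale: minimum of the finitely many `η_x` and `1`
    set S : Finset ℝ := insert 1 (T.image ηf) with hS
    have hSne : S.Nonempty := ⟨1, Finset.mem_insert_self _ _⟩
    set η : ℝ := S.min' hSne with hη
    have hη0' : 0 < η := by
      rw [hη, Finset.lt_min'_iff]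
      intro y hy
      rcases Finset.mem_insert.1 hy with rfl | hy
      · exact one_pos
      · obtain ⟨x, hxT, rfl⟩ := Finset.mem_image.1 hy
        exact hη0 x (hTC x hxT)
    have hηle : ∀ x ∈ T, η ≤ ηf x := fun x hx ↦
      Finset.min'_le _ _ (Finset.mem_insert_of_mem (Finset.mem_image_of_mem _ hx))
    refine ⟨η, hη0', fun x hx _ ↦ ?_⟩
    obtain ⟨i, hiT, hxi⟩ : ∃ i ∈ T, x ∈ Of i := by
      have := hTcov hx
      simpa only [mem_iUnion, exists_prop] using this
    have hiC : i ∈ Cn := hTC i hiT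
    refine ⟨k₁f i, Of i, hOo i hiC, hxi, fun z hz ↦ (hO i hiC z hz).1, fun z hz k hk hkal ↦ ?_⟩
    refine (hO i hiC z hz).2 k hk (hkal.trans ?_)
    exact add_le_add le_rfl (ENNReal.ofReal_le_ofReal (hηle i hiT))
  obtain ⟨η, hη0, hcov⟩ := hcover
  -- ### the admissible sets and their convexity
  set t : Π z : W, Set (TangentSpace (𝓡 5) z) := fun z ↦
    {Yv | G.val z Yv Yv ≤ 1 ∧
      (ENNReal.ofReal (a / 2) ≤ (⨅ k ∈ K, G.edist hG z k) → ∀ k ∈ K,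
        G.edist hG z k ≤ (⨅ k' ∈ K, G.edist hG z k') + ENNReal.ofReal η →
        μ * (G.edist hG z k).toReal ≤ -(G.val z ((Ex z).symm k) Yv)) ∧
      (R₀ ≤ r z → Yv = Y o z)} with ht
  have htc : ∀ z : W, Convex ℝ (t z) := by
    intro z Y₁ hY₁ Y₂ hY₂ c₁ c₂ hc₁ hc₂ hcs
    refine ⟨?_, ?_, ?_⟩
    · -- the unit ball of `G_z` is convex (Cauchy–Schwarz)
      have h1 := hY₁.1
      have h2 := hY₂.1
      have hcs' : |G.val z Y₁ Y₂| ≤ 1 := by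
        have h := Literature.Geometry.Riemannian.abs_val_le_sqrt_mul_sqrt G hnn z Y₁ Y₂
        have hs1 : Real.sqrt (G.val z Y₁ Y₁) ≤ 1 := Real.sqrt_le_one.mpr h1 |>.trans_eq rfl
        have hs2 : Real.sqrt (G.val z Y₂ Y₂) ≤ 1 := Real.sqrt_le_one.mpr h2
        calc |G.val z Y₁ Y₂| ≤ Real.sqrt (G.val z Y₁ Y₁) * Real.sqrt (G.val z Y₂ Y₂) := h
          _ ≤ 1 * 1 := mul_le_mul hs1 hs2 (Real.sqrt_nonneg _) zero_le_one
          _ = 1 := one_mul 1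
      have h_a : G.val z (c₁ • Y₁ + c₂ • Y₂) = c₁ • G.val z Y₁ + c₂ • G.val z Y₂ := by
        rw [map_add, map_smul, map_smul]
      have h_b : ∀ Yv : TangentSpace (𝓡 5) z, G.val z Yv (c₁ • Y₁ + c₂ • Y₂) =
          c₁ * G.val z Yv Y₁ + c₂ * G.val z Yv Y₂ := by
        intro Yv
        rw [map_add, map_smul, map_smul, smul_eq_mul, smul_eq_mul]
      have hexp : G.val z (c₁ • Y₁ + c₂ • Y₂) (c₁ • Y₁ + c₂ • Y₂) =
          c₁ * c₁ * G.val z Y₁ Y₁ + 2 * c₁ * c₂ * G.val z Y₁ Y₂ + c₂ * c₂ * G.val z Y₂ Y₂ := by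
        rw [h_a, _root_.add_apply, _root_.smul_apply, _root_.smul_apply, h_b, h_b,
          G.symm z Y₂ Y₁, smul_eq_mul, smul_eq_mul]
        ring
      rw [hexp]
      have hab : |G.val z Y₁ Y₂| ≤ 1 := hcs'
      rw [abs_le] at hab
      nlinarith [mul_nonneg hc₁ hc₂, hab.1, hab.2, h1, h2, sq_nonneg c₁, sq_nonneg c₂]
    · intro hfz k hk hkal
      have h1 := hY₁.2.1 hfz k hk hkal
      have h2 := hY₂.2.1 hfz k hk hkal
      have hexp : G.val z ((Ex z).symm k) (c₁ • Y₁ + c₂ • Y₂) =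
          c₁ * G.val z ((Ex z).symm k) Y₁ + c₂ * G.val z ((Ex z).symm k) Y₂ := by
        rw [map_add, map_smul, map_smul, smul_eq_mul, smul_eq_mul]
      rw [hexp]
      have : μ * (G.edist hG z k).toReal = c₁ * (μ * (G.edist hG z k).toReal) +
          c₂ * (μ * (G.edist hG z k).toReal) := by rw [← add_mul, hcs, one_mul]
      rw [this]
      nlinarith [mul_le_mul_of_nonneg_left h1 hc₁, mul_le_mul_of_nonneg_left h2 hc₂]
    · intro hR
      rw [hY₁.2.2 hR, hY₂.2.2 hR, ← add_smul, hcs, one_smul]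
  -- ### local realisability
  have hzero : ∀ U : Set W, ContMDiffOn (𝓡 5) ((𝓡 5).prod 𝓘(ℝ, EuclideanSpace ℝ (Fin 5))) ∞
      (fun z : W ↦ TotalSpace.mk' (EuclideanSpace ℝ (Fin 5)) z (0 : TangentSpace (𝓡 5) z)) U :=
    fun U ↦ (contMDiff_zeroSection ℝ (TangentSpace (𝓡 5) : W → Type _)).contMDiffOn
  have Hloc : ∀ x : W, ∃ U ∈ 𝓝 x, ∃ sl : Π z : W, TangentSpace (𝓡 5) z,
      ContMDiffOn (𝓡 5) ((𝓡 5).prod 𝓘(ℝ, EuclideanSpace ℝ (Fin 5))) ∞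
        (fun z : W ↦ TotalSpace.mk' (EuclideanSpace ℝ (Fin 5)) z (sl z)) U ∧
      ∀ z ∈ U, sl z ∈ t z := by
    intro x
    by_cases hA : R₁ < r x
    · -- Case A (far): the radial field from `o`
      refine ⟨{z | R₁ < r z}, (isOpen_lt continuous_const hrc).mem_nhds hA, Y o, ?_, ?_⟩
      · refine (hYs o).mono fun z hz ↦ ?_
        intro hzo
        have : R₁ < r z := hz
        rw [hzo, hro] at this
        linarith
      · intro z hz
        have hz' : R₁ < r z := hz
        have hzo : z ≠ o := by
          intro hzo; rw [hzo, hro] at hz'; linarith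
        refine ⟨le_of_eq (hYunit o z hzo), fun _ k hk _ ↦ ?_, fun _ ↦ rfl⟩
        -- far-field margin: helper 5
        have hoz : ENNReal.ofReal (2 * D) ≤ G.edist hG o z := by
          refine (ENNReal.ofReal_le_iff_le_toReal (hfin o z)).2 ?_
          change 2 * D ≤ r z
          linarith
        have h5 := helper_gradientLikeField_5 W G hG Ex hpol hlip o z k D hD0 (hDK k hk) hoz
        have hrz : 0 < r z := by linarith
        have hrz' : (G.edist hG o z).toReal = r z := rfl
        rw [hYeq o z hzo, map_neg, map_smul, smul_eq_mul, hrz']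
        rw [hrz'] at h5
        have hsym : G.val z ((Ex z).symm k) ((Ex z).symm o) = G.val z ((Ex z).symm o) ((Ex z).symm k) :=
          G.symm z _ _
        rw [hsym, neg_neg]
        have hd0 : 0 ≤ (G.edist hG z k).toReal := ENNReal.toReal_nonneg
        rw [le_inv_mul_iff₀' hrz]
        have hle : μ * (G.edist hG z k).toReal * r z ≤ 1 / 2 * r z * (G.edist hG z k).toReal := by
          nlinarith [mul_nonneg (sub_nonneg.2 hμh) (mul_nonneg hd0 hrz.le)]
        exact hle.trans h5
    · by_cases hB : f x < ENNReal.ofReal (a / 2)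
      · -- Case B (`f < a/2`): the zero field
        refine ⟨{z | f z < ENNReal.ofReal (a / 2)} ∩ {z | r z < R₀}, ?_, fun _ ↦ 0, hzero _, ?_⟩
        · refine ((isOpen_lt hfc continuous_const).inter (isOpen_lt hrc continuous_const)).mem_nhds
            ⟨hB, ?_⟩
          show r x < R₀
          rw [hR₀]; linarith [le_of_not_gt hA]
        · intro z hz
          refine ⟨by simp, fun hfz ↦ absurd hfz (not_le.2 hz.1), fun hR ↦ absurd hR (not_le.2 hz.2)⟩
      · -- Case C (near, `f ≥ a/2`, `r ≤ R₁`)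
        have hxC : x ∈ Cn := hmemCn x (le_of_not_gt hA) (le_of_not_gt hB)
        by_cases hKne : K.Nonempty
        · obtain ⟨k₁, O, hOo, hxO, hOk, hmargin⟩ := hcov x hxC hKne
          refine ⟨O ∩ {z | r z < R₀}, ?_, Y k₁, ?_, ?_⟩
          · refine (hOo.inter (isOpen_lt hrc continuous_const)).mem_nhds ⟨hxO, ?_⟩
            show r x < R₀
            rw [hR₀]; linarith [le_of_not_gt hA]
          · exact (hYs k₁).mono fun z hz ↦ hOk z hz.1
          · intro z hz
            have hzk : z ≠ k₁ := hOk z hz.1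
            refine ⟨le_of_eq (hYunit k₁ z hzk), fun _ k hk hkal ↦ ?_,
              fun hR ↦ absurd hR (not_le.2 hz.2)⟩
            have hm := hmargin z hz.1 k hk hkal
            have hd1 : 0 < (G.edist hG z k₁).toReal := by
              refine ENNReal.toReal_pos ?_ (hfin z k₁)
              intro h0'
              exact hzk ((G.edist_eq_zero_iff hG).1 h0')
            have hd1' : (G.edist hG k₁ z).toReal = (G.edist hG z k₁).toReal := by
              rw [G.edist_comm hG]
            rw [hYeq k₁ z hzk, map_neg, map_smul, smul_eq_mul, hd1']
            have hsym : G.val z ((Ex z).symm k) ((Ex z).symm k₁) =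
                G.val z ((Ex z).symm k₁) ((Ex z).symm k) := G.symm z _ _
            rw [hsym, neg_neg, le_inv_mul_iff₀' hd1]
            calc μ * (G.edist hG z k).toReal * (G.edist hG z k₁).toReal
                = μ * (G.edist hG z k₁).toReal * (G.edist hG z k).toReal := by ring
              _ ≤ _ := hm
        · -- `K = ∅`: no directional constraint
          have hKe : K = ∅ := Set.not_nonempty_iff_eq_empty.1 hKne
          refine ⟨{z | r z < R₀}, (isOpen_lt hrc continuous_const).mem_nhds ?_, fun _ ↦ 0,
            hzero _, ?_⟩
          · show r x < R₀
            rw [hR₀]; linarith [le_of_not_gt hA]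
          · intro z hz
            refine ⟨by simp, fun _ k hk ↦ ?_, fun hR ↦ absurd hR (not_le.2 hz)⟩
            rw [hKe] at hk
            exact absurd hk (Set.notMem_empty k)
  -- ### the global smooth section
  obtain ⟨s, hs⟩ := exists_contMDiffSection_forall_mem_convex_of_local (𝓡 5)
    (n := (⊤ : ℕ∞)) (F_fiber := EuclideanSpace ℝ (Fin 5)) (TangentSpace (𝓡 5) : W → Type _) t htc
    (fun x ↦ by
      obtain ⟨U, hU, sl, hsl, hslt⟩ := Hloc x
      exact ⟨U, hU, sl, hsl, hslt⟩)
  -- ### conclusions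
  refine ⟨s, μ, o, R₀, e, hμ0, hR₀0, s.contMDiff, fun y ↦ (hs y).1, ?_, h0 o, hpol o, ?_⟩
  · -- Lyapunov growth: helper 3
    intro γ t₁ t₂ ht hγ hfa
    exact helper_gradientLikeField_3 W G hG Ex hpol hgauss hrev K hK s a μ η ha hμ0 hη0
      (fun z hz k hk hkal ↦ (hs z).2.1 hz k hk hkal) γ t₁ t₂ ht hγ hfa
  · -- the radial zone
    intro v hv
    have hR : R₀ ≤ r (e v) := by rw [hre]; exact hv
    have h1 : s (e v) = Y o (e v) := (hs (e v)).2.2 hR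
    rw [h1, he]
    exact hYrad o v

end Summit.SmoothPoincare4.SmoothPoincare4.Cruxes.C0AhRecognition.CoreDistanceMorse

end
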